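import Mathlib
import Summits.Ventures.HodgeRepro2.Tier7.Line3.KappaPlaces
import Summits.Ventures.HodgeRepro2.T7SupportBergmanOrbitalDecay

/-!
# Tier 7 — LINE 3 support: the `a_bound` decay read in the adapted invariant
(`Line3/KappaDecay.lean`; t7-L1-p5, gen 2; continues `Line3/KappaPlaces.lean`)

p1's `T7SupportBergmanOrbitalDecay.norm_torus_orbital_conj_le_kappa` bounds the two-torus orbital integral of the
explicit model (`SU(1,1)`, tori `K` and `h K h⁻¹`, the `D_k` matrix coefficient) by `C · κ(γ)^{−k/2}` with
`κ = kappa conj dd (colBasis h) (mat γ)` — the model's invariant. This file reads that bound in the §2a invariant of the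
ADAPTED coordinates: for a `Sig11Data r s f` (a `(1,1)`-place, positive lines first) and ANY isometry `γ` of the adapted
form, `Sig11Data.exists_SU11_kappa` produces a phase `c` (`|c| = 1`) and `γ′, h ∈ SU(1,1)` with `mat γ′ = P (c • γ) Q` and
`kappa conj dd (colBasis h) (mat γ′) = kappa conj r f γ` — the model's pair `(γ′, h)` represents `(γ, T_A, T_B)`: the
diagonal torus goes to `K`, the stabiliser of the lines of `f` to `h K h⁻¹`, the phase `c` is central — and
`Sig11Data.torus_orbital_decay` then states p1's decay with the adapted `κ` in the exponent:
`‖∫_K ∫_K ⟨π_k(rot u · γ′ · h rot v h⁻¹) π_k(h) zʲ, zⁿ⟩_k u^p conj(v^q)‖ ≤ decayConst k j n · monomialNormSq k n ·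
(Re κ_{r,f}(γ))^{−k/2}` for every `k ≥ 2`, `j, n, p, q`.

What stays in words: that `(γ′, h)` is the real `(γ, T_A, T_B)` at `ι_j` beyond the coordinates (the §0 signature
statement); nothing about the real test function, the centre (the lead's row U1), periods or (N).
Sorry-free; axioms: propext / Classical.choice / Quot.sound. §8(d): uses an L-value-free non-vanishing device: NO.
-/

namespace Summit.Ventures.HodgeRepro2.Tier7.Line3.KappaDecay

open Matrix MeasureTheory Summit.Ventures.HodgeRepro2.T7SupportTwoTorusInvariant
  Summit.Ventures.HodgeRepro2.Tier7.Line3.KappaNatural Summit.Ventures.HodgeRepro2.Tier7.Line3.KappaArchimedean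
  Summit.Ventures.HodgeRepro2.Tier7.Line3.KappaPlaces
open Summit.Ventures.HodgeRepro2.T7SupportKappaCartan (dd colBasis)
open Summit.Ventures.HodgeRepro2.T5SU11Unimodular (SU11)
open Summit.Ventures.HodgeRepro2.T5BergmanCoefficient (mat act)
open Summit.Ventures.HodgeRepro2.T5SU11Fibration (rot)
open Summit.Ventures.HodgeRepro2.T5BergmanMatrixCoeff (matrixCoeff)
open Summit.Ventures.HodgeRepro2.T5HaarCircle (haarCircle)
open Summit.Ventures.HodgeRepro2.T5BergmanKTypeMatrix (decayConst)
open Summit.Ventures.HodgeRepro2.T5BergmanParseval (monomialNormSq)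

/-- **the model pair representing the adapted datum**: for every isometry `γ` of the adapted `(1,1)`-form there are a
phase `c` and `γ′, h ∈ SU(1,1)` with `mat γ′ = P (c • γ) Q` and the model's invariant of `(γ′, h)` EQUAL to the adapted
invariant `κ_{r,f}(γ)`. -/
theorem Sig11Data.exists_SU11_kappa {r s : Fin 2 → ℝ} {f : Fin 2 → Fin 2 → ℂ} (D : Sig11Data r s f)
    {γ : Matrix (Fin 2) (Fin 2) ℂ} (hγ : IsIsom (starRingEnd ℂ) (fun i => (r i : ℂ)) γ) :
    ∃ c : ℂ, Complex.normSq c = 1 ∧ ∃ γ' h : SU11, mat γ' = P r * (c • γ) * Q r ∧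
      kappa (starRingEnd ℂ) dd (colBasis h) (mat γ') = kappa (starRingEnd ℂ) (fun i => (r i : ℂ)) f γ := by
  obtain ⟨c, hc, γ', h, hmat, hk⟩ := KappaPlaces.Sig11Data.exists_SU11' D hγ
  exact ⟨c, hc, γ', h, hmat, by rw [hk, Summit.Ventures.HodgeRepro2.T7SupportKappaCartan.kappa_eq_normSq]⟩

/-- **the `a_bound` decay in the adapted invariant**: p1's bound `≤ C κ^{−k/2}` for the representing pair `(γ′, h)`,
with the §2a invariant `κ_{r,f}(γ)` of the adapted coordinates in the exponent. -/
theorem Sig11Data.torus_orbital_decay [MeasurableSpace Circle] [BorelSpace Circle] {r s : Fin 2 → ℝ}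
    {f : Fin 2 → Fin 2 → ℂ} (D : Sig11Data r s f) {γ : Matrix (Fin 2) (Fin 2) ℂ}
    (hγ : IsIsom (starRingEnd ℂ) (fun i => (r i : ℂ)) γ) :
    ∃ c : ℂ, Complex.normSq c = 1 ∧ ∃ γ' h : SU11, mat γ' = P r * (c • γ) * Q r ∧
      ∀ (k j n : ℕ), 2 ≤ k → ∀ (p q : ℤ),
        ‖∫ u : Circle, ∫ v : Circle,
            matrixCoeff k (act k h (fun w => w ^ j)) (fun w => w ^ n) (rot u * γ' * (h * rot v * h⁻¹)) *
              ((u : ℂ) ^ p * (starRingEnd ℂ) ((v : ℂ) ^ q)) ∂haarCircle ∂haarCircle‖ ≤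
          decayConst k j n * monomialNormSq k n *
            (kappa (starRingEnd ℂ) (fun i => (r i : ℂ)) f γ).re ^ (-(k : ℝ) / 2) := by
  obtain ⟨c, hc, γ', h, hmat, hk⟩ := Sig11Data.exists_SU11_kappa D hγ
  refine ⟨c, hc, γ', h, hmat, fun k j n hk2 p q => ?_⟩
  have := Summit.Ventures.HodgeRepro2.T7SupportBergmanOrbitalDecay.norm_torus_orbital_conj_le_kappa k j n hk2 h γ' p q
  rw [hk] at this
  exact this

end Summit.Ventures.HodgeRepro2.Tier7.Line3.KappaDecay
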